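import Summits.QuantumFields.BalabanUV.T4Continuum.Support.ScalarCovariantLaplacianBounds
import Summits.QuantumFields.BalabanUV.T4Continuum.Support.ScalarPlantingDefect
import Summits.QuantumFields.BalabanUV.T4Continuum.Support.FirstOrderAdjointModel

/-!
# T⁴ programme, spine node NE2 (U1a) — THE COLOUR SCALAR LAYER, file 2a: KING'S 0-FORM PLANTING AGAINST FACES, SHIFTS AND
# COLOUR MULTIPLICATIONS (tier B, supplier row B4.e of `t4/formal/NE2/LEAVES.md`)

NE2 formalisation swarm `b2b-balaban-t4-ne2-formalise-*`, leaf 01 (row B4.e, file 2a; companions `Support/ScalarCovariantLaplacian` p208899,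
`Support/ScalarCovariantLaplacianBounds` p209123).  The (H-cons) half of the scalar-layer `PerturbationLaws` compares the perturbation at
two adjacent spacings through the 0-FORM King planting `J₀ = ScalarBlockPlanting.JK0` (leaf 04).  This file supplies the exact two-level
ALGEBRA it needs, obtained from the 1-form identities of the lineage (`BlockPairingGeometry`/`BlockPairingFaces`/`FirstOrderAdjointModel`,
stated for `JK = J_R` on `T × {1..d}`) by TRANSPORT ALONG THE COMPONENT EMBEDDING `emb` of leaf 04 (`S_ν·emb = emb·S⁰_ν`,
`Q·emb = emb·Q₀`, `Π·emb = emb·Π₀`; here `+ S_νᴴ`, `∇_ν`, `∇_νᴴ`, `F_μ`, `J_R`):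
 * §1 **`sdiff_mul_JK0`** `∂′_μ J₀ = R·F⁰_μ·J₀·∂_μ` (a fine difference of a block-constant field lives on the far faces `F⁰_μ`),
   **`Pi0_mul_face_defect_mul_JK0`** `Π₀·(R·F⁰_μ − 1)·J₀ = 0`, **`Pi0_mul_adjoint_defect0`** `Π₀·(∂′_μᴴJ₀ − J₀∂_μᴴ) = 0`, and the norms
   `‖F⁰_μ‖ ≤ 1`, `‖R·F⁰_μ − 1‖ ≤ R + 1`;
 * §2 colour lifts: **`kronJK0_mul_siteMul`** `(J₀ ⊗ 1)·siteMul w = siteMul (w ∘ par)·(J₀ ⊗ 1)`, diagonal weights commute with colour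
   multiplications, and the one-derivative bounds **`opNorm_kronSdiff_siteMul_Gps_le`** / **`opNorm_kronSdiffH_siteMul_Gps_le`**
   `‖(∂_μ ⊗ 1)·siteMul v·(G′ ⊗ 1)‖, ‖(∂_μ ⊗ 1)ᴴ·siteMul v·(G′ ⊗ 1)‖ ≤ α√g + βg` (Leibniz + row B4.c's `‖∂G′‖ ≤ √g`, `‖G′‖ ≤ g = γ′⁻¹`);
 * §3 the scalar block averagings pair EXACTLY through `J₀`: **`QsOp_mul_Qavg0H`** `Q′_{RN}·Q₀ᴴ = R^{−d}·Q′_N`, **`Bs_mul_kronJK0`**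
   `B_{RN}·(J₀ ⊗ 1) = B_N` (the `q₁ = 0` pairing of the free scalar averaging `B = √(n^d)·Q′ ⊗ 1`).

HONEST FRAMING (T4-DAG p. 1).  [folklore] finite-lattice bookkeeping, OURS; `U = 1` objects and DATA only; NOT [B9] (3.23)–(3.26) as printed;
NE2 NOT proved; spine count 0/9 UNCHANGED; NOT infinite volume / mass gap / Clay.  HONEST DEPENDENCY LINE: continuum YM on T⁴ ⇐ BetaPertH ∧
nine spine estimates (0/9 proved); BetaPertH ⇐ (D1) ∧ (D4) ∧ CAP+tail; G-an2-4 gates asym, D1 and NE2/3/4.  ABSOLUTE RULE kept; no `sorry`.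
-/

noncomputable section

open scoped BigOperators ComplexConjugate Matrix Matrix.Norms.L2Operator Kronecker

namespace Summit.QuantumFields.BalabanUV.T4Continuum.ScalarPlantingFaces

open Literature.MathematicalPhysics.QuantumFieldTheory.Balaban1983to89.B5Prop11Plancherel (Tor fine unitVec fdiff shiftM)
open Literature.MathematicalPhysics.QuantumFieldTheory.Balaban1983to89.B5Action121 (shiftS sdiff)
open Literature.MathematicalPhysics.QuantumFieldTheory.Balaban1983to89.B5Block118 (QsOp)
open Literature.MathematicalPhysics.QuantumFieldTheory.Balaban1983to89.B5Blocks16 (blockOf)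
open Literature.MathematicalPhysics.QuantumFieldTheory.Balaban1983to89.B5G183RateTorus (cpt)
open Literature.MathematicalPhysics.QuantumFieldTheory.Balaban1983to89.B5G183RateTorusW (off Qavg)
open Summit.QuantumFields.BalabanUV.T4Continuum
open Summit.QuantumFields.BalabanUV.T4Continuum.KroneckerLift
open Summit.QuantumFields.BalabanUV.T4Continuum.BlockMultiplication
open Summit.QuantumFields.BalabanUV.T4Continuum.BalabanAveragedTowerModes (par par_cpt_add_off)
open Summit.QuantumFields.BalabanUV.T4Continuum.BalabanBlockPoincare (Pi)
open Summit.QuantumFields.BalabanUV.T4Continuum.KingPairingPlantedLaw (JK opNorm_JK_le sqrt_facts)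
open Summit.QuantumFields.BalabanUV.T4Continuum.BlockPairingGeometry (faceF fdiff_mul_JK conjTranspose_shiftM_mul)
open Summit.QuantumFields.BalabanUV.T4Continuum.BlockPairingFaces (Pi_mul_face_defect_mul_JK)
open Summit.QuantumFields.BalabanUV.T4Continuum.FirstOrderAdjointModel (Pi_mul_adjoint_defect)
open Summit.QuantumFields.BalabanUV.T4Continuum.GaugeTermDecomposition (sdiff_def opNorm_shiftS_le)
open Summit.QuantumFields.BalabanUV.T4Continuum.ScalarBlockPoincare (PiS QsOp_apply_blockOf)
open Summit.QuantumFields.BalabanUV.T4Continuum.ScalarAveragedPropagator (gammaPs Gps gammaPs_pos opNorm_Gps_le opNorm_sdiff_mul_Gps_le)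
open Summit.QuantumFields.BalabanUV.T4Continuum.ScalarBlockPlanting
open Summit.QuantumFields.BalabanUV.T4Continuum.ScalarPlantingDefect (blockOf_par)
open Summit.QuantumFields.BalabanUV.T4Continuum.ScalarCovariantLaplacian (conjTranspose_shiftS_mul_shiftS kronSdiff_conjTranspose
  kronSdiff_mul_siteMul Bs)

variable {d : ℕ} {o : Type*} [Fintype o] [DecidableEq o]

/-! ## §1 Transport along the component embedding: faces, differences and the planting on 0-forms -/

section Emb

variable (Nf : Fin d → ℕ) [hNf : ∀ μ, NeZero (Nf μ)]

/-- **the backward shifts intertwine too**: `S_νᴴ·emb = emb·(S⁰_ν)ᴴ` (both shifts are unitary). [folklore] -/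
theorem shiftMH_mul_emb (ν μ₀ : Fin d) : (shiftM Nf ν)ᴴ * emb Nf μ₀ = emb Nf μ₀ * (shiftS Nf ν)ᴴ := by
  have h1 : (shiftM Nf ν)ᴴ * shiftM Nf ν = 1 := conjTranspose_shiftM_mul Nf ν
  have h2 : shiftS Nf ν * (shiftS Nf ν)ᴴ = 1 := mul_eq_one_comm.mp (conjTranspose_shiftS_mul_shiftS Nf ν)
  calc (shiftM Nf ν)ᴴ * emb Nf μ₀ = (shiftM Nf ν)ᴴ * emb Nf μ₀ * (shiftS Nf ν * (shiftS Nf ν)ᴴ) := by rw [h2, Matrix.mul_one]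
    _ = (shiftM Nf ν)ᴴ * (shiftM Nf ν * emb Nf μ₀) * (shiftS Nf ν)ᴴ := by rw [shiftM_mul_emb]; simp only [Matrix.mul_assoc]
    _ = emb Nf μ₀ * (shiftS Nf ν)ᴴ := by rw [← Matrix.mul_assoc, h1, Matrix.one_mul]

/-- `∇_ν·emb = emb·∂_ν`. [folklore] -/
theorem fdiff_mul_emb (c : ℂ) (ν μ₀ : Fin d) : fdiff Nf c ν * emb Nf μ₀ = emb Nf μ₀ * sdiff Nf c ν := by
  rw [fdiff, sdiff_def, Matrix.smul_mul, Matrix.sub_mul, Matrix.one_mul, shiftM_mul_emb, Matrix.mul_smul, Matrix.mul_sub,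
    Matrix.mul_one]

/-- `∇_νᴴ·emb = emb·∂_νᴴ`. [folklore] -/
theorem fdiffH_mul_emb (c : ℂ) (ν μ₀ : Fin d) : (fdiff Nf c ν)ᴴ * emb Nf μ₀ = emb Nf μ₀ * (sdiff Nf c ν)ᴴ := by
  rw [fdiff, sdiff_def, Matrix.conjTranspose_smul, Matrix.conjTranspose_sub, Matrix.conjTranspose_one, Matrix.smul_mul,
    Matrix.sub_mul, Matrix.one_mul, shiftMH_mul_emb, Matrix.conjTranspose_smul, Matrix.conjTranspose_sub,
    Matrix.conjTranspose_one, Matrix.mul_smul, Matrix.mul_sub, Matrix.mul_one]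

end Emb

section TwoLevel

variable (N R : ℕ) [NeZero N] [NeZero R] (M : Fin d → ℕ) [hM : ∀ μ, NeZero (M μ)]

/-- the diagonal indicator `F⁰_μ` of the far `μ`-face of the `R`-blocks, on 0-forms (`R ∣ x′_μ + 1`). [folklore] -/
def faceF0 (μ : Fin d) : Matrix (Tor (fine (R * N) M)) (Tor (fine (R * N) M)) ℂ :=
  Matrix.diagonal fun x => if R ∣ (x μ).val + 1 then 1 else 0

/-- `F_μ·emb = emb·F⁰_μ`. [folklore] -/
theorem faceF_mul_emb (μ μ₀ : Fin d) : faceF N R M μ * emb (fine (R * N) M) μ₀ = emb (fine (R * N) M) μ₀ * faceF0 N R M μ := by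
  ext i y
  rw [faceF, faceF0, Matrix.diagonal_mul, Matrix.mul_diagonal]
  by_cases h : i = (y, μ₀)
  · subst h; simp [emb]
  · simp [emb, h]

/-- `(R·F_μ − 1)·emb = emb·(R·F⁰_μ − 1)`. [folklore] -/
theorem faceDefect_mul_emb (μ μ₀ : Fin d) :
    (((R : ℂ)) • faceF N R M μ - 1) * emb (fine (R * N) M) μ₀ = emb (fine (R * N) M) μ₀ * (((R : ℂ)) • faceF0 N R M μ - 1) := by
  rw [Matrix.sub_mul, Matrix.smul_mul, faceF_mul_emb, Matrix.one_mul, Matrix.mul_sub, Matrix.mul_smul, Matrix.mul_one]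

/-- `J_R·emb = emb·J₀` (King's plantings of 1-forms and of 0-forms). [folklore] -/
theorem JK_mul_emb (μ₀ : Fin d) : JK N R M * emb (fine N M) μ₀ = emb (fine (R * N) M) μ₀ * JK0 N R M := by
  rw [JK, JK0, Matrix.smul_mul, QavgH_mul_emb, Matrix.mul_smul]

/-- TRANSPORT: an operator on 0-forms intertwined with one on 1-forms is its `μ₀`-component compression. [folklore] -/
theorem eq_of_emb_intertwine {X : Matrix (Tor (fine (R * N) M) × Fin d) (Tor (fine N M) × Fin d) ℂ}
    {X₀ : Matrix (Tor (fine (R * N) M)) (Tor (fine N M)) ℂ} (μ₀ : Fin d)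
    (h : X * emb (fine N M) μ₀ = emb (fine (R * N) M) μ₀ * X₀) :
    X₀ = (emb (fine (R * N) M) μ₀)ᴴ * X * emb (fine N M) μ₀ := by
  rw [Matrix.mul_assoc, h, ← Matrix.mul_assoc, embH_mul_emb, Matrix.one_mul]

/-- **`∂′_μ J₀ = R·F⁰_μ J₀ ∂_μ`** (`∂′ = (RN)(S′ − 1)`, `∂ = N(S − 1)`): the 0-form twin of `BlockPairingGeometry.fdiff_mul_JK`.
[cite: King1986, (2.10) p.653] [folklore] -/
theorem sdiff_mul_JK0 (hN : 1 ≤ N) (μ : Fin d) :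
    sdiff (fine (R * N) M) (((R * N : ℕ)) : ℂ) μ * JK0 N R M
      = ((R : ℂ)) • (faceF0 N R M μ * JK0 N R M * sdiff (fine N M) ((N : ℕ) : ℂ) μ) := by
  have hX : (fdiff (fine (R * N) M) (((R * N : ℕ)) : ℂ) μ * JK N R M) * emb (fine N M) μ
      = emb (fine (R * N) M) μ * (sdiff (fine (R * N) M) (((R * N : ℕ)) : ℂ) μ * JK0 N R M) := by
    rw [Matrix.mul_assoc, JK_mul_emb, ← Matrix.mul_assoc, fdiff_mul_emb, Matrix.mul_assoc]
  have hY : (((R : ℂ)) • (faceF N R M μ * JK N R M * fdiff (fine N M) ((N : ℕ) : ℂ) μ)) * emb (fine N M) μ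
      = emb (fine (R * N) M) μ * (((R : ℂ)) • (faceF0 N R M μ * JK0 N R M * sdiff (fine N M) ((N : ℕ) : ℂ) μ)) := by
    rw [Matrix.smul_mul, Matrix.mul_smul]
    congr 1
    calc faceF N R M μ * JK N R M * fdiff (fine N M) ((N : ℕ) : ℂ) μ * emb (fine N M) μ
        = faceF N R M μ * JK N R M * (fdiff (fine N M) ((N : ℕ) : ℂ) μ * emb (fine N M) μ) := by simp only [Matrix.mul_assoc]
      _ = faceF N R M μ * (JK N R M * emb (fine N M) μ) * sdiff (fine N M) ((N : ℕ) : ℂ) μ := by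
          rw [fdiff_mul_emb]; simp only [Matrix.mul_assoc]
      _ = (faceF N R M μ * emb (fine (R * N) M) μ) * JK0 N R M * sdiff (fine N M) ((N : ℕ) : ℂ) μ := by
          rw [JK_mul_emb]; simp only [Matrix.mul_assoc]
      _ = emb (fine (R * N) M) μ * (faceF0 N R M μ * JK0 N R M * sdiff (fine N M) ((N : ℕ) : ℂ) μ) := by
          rw [faceF_mul_emb]; simp only [Matrix.mul_assoc]
  calc sdiff (fine (R * N) M) (((R * N : ℕ)) : ℂ) μ * JK0 N R M
      = (emb (fine (R * N) M) μ)ᴴ * (fdiff (fine (R * N) M) (((R * N : ℕ)) : ℂ) μ * JK N R M) * emb (fine N M) μ :=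
        eq_of_emb_intertwine N R M μ hX
    _ = (emb (fine (R * N) M) μ)ᴴ * (((R : ℂ)) • (faceF N R M μ * JK N R M * fdiff (fine N M) ((N : ℕ) : ℂ) μ)) * emb (fine N M) μ := by
        rw [fdiff_mul_JK N R M hN μ]
    _ = _ := (eq_of_emb_intertwine N R M μ hY).symm

/-- **`Π₀·(R·F⁰_μ − 1)·J₀ = 0`**: the weight `R·𝟙_{far face} − 1` has zero mean on every block (0-form twin of
`BlockPairingFaces.Pi_mul_face_defect_mul_JK`). [folklore] -/
theorem Pi0_mul_face_defect_mul_JK0 (hd : 1 ≤ d) (μ : Fin d) :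
    Pi0 N R M * (((R : ℂ)) • faceF0 N R M μ - 1) * JK0 N R M = 0 := by
  have hX : (Pi N R M * (((R : ℂ)) • faceF N R M μ - 1) * JK N R M) * emb (fine N M) μ
      = emb (fine (R * N) M) μ * (Pi0 N R M * (((R : ℂ)) • faceF0 N R M μ - 1) * JK0 N R M) := by
    calc _ = Pi N R M * (((R : ℂ)) • faceF N R M μ - 1) * (JK N R M * emb (fine N M) μ) := by simp only [Matrix.mul_assoc]
      _ = Pi N R M * ((((R : ℂ)) • faceF N R M μ - 1) * emb (fine (R * N) M) μ) * JK0 N R M := by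
          rw [JK_mul_emb]; simp only [Matrix.mul_assoc]
      _ = (Pi N R M * emb (fine (R * N) M) μ) * (((R : ℂ)) • faceF0 N R M μ - 1) * JK0 N R M := by
          rw [faceDefect_mul_emb]; simp only [Matrix.mul_assoc]
      _ = _ := by rw [Pi_mul_emb]; simp only [Matrix.mul_assoc]
  rw [eq_of_emb_intertwine N R M μ hX, Pi_mul_face_defect_mul_JK N R M hd μ, Matrix.mul_zero, Matrix.zero_mul]

/-- **`Π₀·(∂′_μᴴ J₀ − J₀ ∂_μᴴ) = 0`**: the backward-difference defect of a planted 0-form has no block-constant component (0-form twin of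
`FirstOrderAdjointModel.Pi_mul_adjoint_defect`). [folklore] -/
theorem Pi0_mul_adjoint_defect0 (hd : 1 ≤ d) (hN : 1 ≤ N) (μ : Fin d) :
    Pi0 N R M * ((sdiff (fine (R * N) M) (((R * N : ℕ)) : ℂ) μ)ᴴ * JK0 N R M - JK0 N R M * (sdiff (fine N M) ((N : ℕ) : ℂ) μ)ᴴ) = 0 := by
  have h1 : ((fdiff (fine (R * N) M) (((R * N : ℕ)) : ℂ) μ)ᴴ * JK N R M - JK N R M * (fdiff (fine N M) ((N : ℕ) : ℂ) μ)ᴴ)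
        * emb (fine N M) μ
      = emb (fine (R * N) M) μ * ((sdiff (fine (R * N) M) (((R * N : ℕ)) : ℂ) μ)ᴴ * JK0 N R M
          - JK0 N R M * (sdiff (fine N M) ((N : ℕ) : ℂ) μ)ᴴ) := by
    rw [Matrix.sub_mul, Matrix.mul_sub]
    congr 1
    · rw [Matrix.mul_assoc, JK_mul_emb, ← Matrix.mul_assoc, fdiffH_mul_emb, Matrix.mul_assoc]
    · rw [Matrix.mul_assoc, fdiffH_mul_emb, ← Matrix.mul_assoc, JK_mul_emb, Matrix.mul_assoc]
  have hX : (Pi N R M * ((fdiff (fine (R * N) M) (((R * N : ℕ)) : ℂ) μ)ᴴ * JK N R M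
        - JK N R M * (fdiff (fine N M) ((N : ℕ) : ℂ) μ)ᴴ)) * emb (fine N M) μ
      = emb (fine (R * N) M) μ * (Pi0 N R M * ((sdiff (fine (R * N) M) (((R * N : ℕ)) : ℂ) μ)ᴴ * JK0 N R M
          - JK0 N R M * (sdiff (fine N M) ((N : ℕ) : ℂ) μ)ᴴ)) := by
    rw [Matrix.mul_assoc, h1, ← Matrix.mul_assoc, Pi_mul_emb, Matrix.mul_assoc]
  rw [eq_of_emb_intertwine N R M μ hX, Pi_mul_adjoint_defect N R M hd hN μ, Matrix.mul_zero, Matrix.zero_mul]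

/-- `‖F⁰_μ‖ ≤ 1`. [folklore] -/
theorem opNorm_faceF0_le (μ : Fin d) : ‖faceF0 N R M μ‖ ≤ 1 := by
  refine Literature.MathematicalPhysics.QuantumFieldTheory.Balaban1983to89.B5G183RateL2Op.opNorm_diagonal_le _ zero_le_one fun x => ?_
  split_ifs <;> simp

/-- `‖R·F⁰_μ − 1‖ ≤ R + 1`. [folklore] -/
theorem opNorm_faceDefect0_le (μ : Fin d) : ‖((R : ℂ)) • faceF0 N R M μ - 1‖ ≤ R + 1 := by
  refine (norm_sub_le _ _).trans (add_le_add ?_ BackgroundResolventLaw.l2_opNorm_one_le)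
  rw [norm_smul, Complex.norm_natCast]
  calc (R : ℝ) * ‖faceF0 N R M μ‖ ≤ R * 1 := mul_le_mul_of_nonneg_left (opNorm_faceF0_le N R M μ) (Nat.cast_nonneg R)
    _ = R := mul_one _

/-! ## §2 Colour lifts: the planting, diagonal weights and one derivative against colour multiplications -/

/-- **`(J₀ ⊗ 1)·siteMul w = siteMul (w ∘ par)·(J₀ ⊗ 1)`**: planting then multiplying by a colour field is multiplying the coarse field by
`w ∘ par` first. [cite: King1986, (2.10) p.653] [folklore] -/
theorem kronJK0_mul_siteMul (w : Tor (fine N M) → Matrix o o ℂ) :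
    JK0 N R M ⊗ₖ (1 : Matrix o o ℂ) * siteMul w = siteMul (w ∘ par N R M) * JK0 N R M ⊗ₖ (1 : Matrix o o ℂ) := by
  refine kron_mul_siteMul_eq fun x y hxy => ?_
  have hy : par N R M x = y := by
    by_contra hne
    apply hxy
    simp [JK0, Qavg0, hne]
  subst hy; rfl

omit [NeZero N] [NeZero R] hM in
/-- diagonal site weights commute with colour multiplications. [folklore] -/
theorem kronDiagonal_mul_siteMul {ι : Type*} [Fintype ι] [DecidableEq ι] (g : ι → ℂ) (v : ι → Matrix o o ℂ) :
    Matrix.diagonal g ⊗ₖ (1 : Matrix o o ℂ) * siteMul v = siteMul v * Matrix.diagonal g ⊗ₖ (1 : Matrix o o ℂ) := by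
  refine kron_mul_siteMul_eq fun x y hxy => ?_
  by_cases h : x = y
  · rw [h]
  · exact absurd (Matrix.diagonal_apply_ne g h) hxy

/-- the face weight `(R·F⁰_μ − 1) ⊗ 1` commutes with colour multiplications. [folklore] -/
theorem faceDefect_kron_mul_siteMul (μ : Fin d) (u : Tor (fine (R * N) M) → Matrix o o ℂ) :
    (((R : ℂ)) • faceF0 N R M μ - 1) ⊗ₖ (1 : Matrix o o ℂ) * siteMul u
      = siteMul u * (((R : ℂ)) • faceF0 N R M μ - 1) ⊗ₖ (1 : Matrix o o ℂ) := by
  rw [sub_kronecker, Matrix.smul_kronecker, Matrix.one_kronecker_one, Matrix.sub_mul, Matrix.one_mul, Matrix.smul_mul, faceF0,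
    kronDiagonal_mul_siteMul, Matrix.mul_sub, Matrix.mul_one, Matrix.mul_smul]

/-- the face indicator `F⁰_μ ⊗ 1` commutes with colour multiplications. [folklore] -/
theorem faceF0_kron_mul_siteMul (μ : Fin d) (u : Tor (fine (R * N) M) → Matrix o o ℂ) :
    faceF0 N R M μ ⊗ₖ (1 : Matrix o o ℂ) * siteMul u = siteMul u * faceF0 N R M μ ⊗ₖ (1 : Matrix o o ℂ) := by
  rw [faceF0, kronDiagonal_mul_siteMul]

/-- **ONE FORWARD DERIVATIVE THROUGH A COLOUR FIELD**: `‖(∂_μ ⊗ 1)·siteMul v·(G′ ⊗ 1)‖ ≤ α√g + βg` for `‖v‖ ≤ α`,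
`‖v(· + e_μ) − v‖ ≤ β/N` (Leibniz; `‖∂_μG′‖ ≤ √g`, `‖G′‖ ≤ g = γ′⁻¹`). [folklore] -/
theorem opNorm_kronSdiff_siteMul_Gps_le {a' : ℝ} (ha' : 0 < a') (μ : Fin d) {v : Tor (fine N M) → Matrix o o ℂ} {α β : ℝ}
    (hα : 0 ≤ α) (hβ : 0 ≤ β) (hv : ∀ x, ‖v x‖ ≤ α) (hvd : ∀ x, ‖v (x + unitVec (fine N M) μ) - v x‖ ≤ β / N) :
    ‖sdiff (fine N M) ((N : ℕ) : ℂ) μ ⊗ₖ (1 : Matrix o o ℂ) * siteMul v * (Gps N M a' ⊗ₖ (1 : Matrix o o ℂ))‖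
      ≤ α * Real.sqrt ((gammaPs d a')⁻¹) + β * (gammaPs d a')⁻¹ := by
  have hn0 : (0 : ℝ) < N := by exact_mod_cast Nat.pos_of_ne_zero (NeZero.ne N)
  have hvb : ∀ x, ‖v (x + unitVec (fine N M) μ)‖ ≤ α := fun x => hv _
  rw [kronSdiff_mul_siteMul, Matrix.add_mul, Matrix.smul_mul, Matrix.mul_assoc, ← kron_mul]
  refine (norm_add_le _ _).trans (add_le_add ?_ ?_)
  · exact (Matrix.l2_opNorm_mul _ _).trans (mul_le_mul (opNorm_siteMul_le _ hα hvb)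
      (opNorm_kron_le_of_le o (opNorm_sdiff_mul_Gps_le N M ha' μ)) (norm_nonneg _) hα)
  · rw [norm_smul, Complex.norm_natCast, ← siteMul_sub]
    calc (N : ℝ) * ‖siteMul (fun i => v (i + unitVec (fine N M) μ) - v i) * (Gps N M a' ⊗ₖ (1 : Matrix o o ℂ))‖
        ≤ (N : ℝ) * (β / N * (gammaPs d a')⁻¹) := by
          refine mul_le_mul_of_nonneg_left ((Matrix.l2_opNorm_mul _ _).trans (mul_le_mul (opNorm_siteMul_le _ (by positivity) hvd)
            (opNorm_kron_le_of_le o (opNorm_Gps_le N M ha')) (norm_nonneg _) (by positivity))) hn0.le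
      _ = β * (gammaPs d a')⁻¹ := by field_simp

/-- **ONE BACKWARD DERIVATIVE THROUGH A COLOUR FIELD**: `‖(∂_μ ⊗ 1)ᴴ·siteMul v·(G′ ⊗ 1)‖ ≤ α√g + βg` (`∂ᴴ = −Sᴴ∂`). [folklore] -/
theorem opNorm_kronSdiffH_siteMul_Gps_le {a' : ℝ} (ha' : 0 < a') (μ : Fin d) {v : Tor (fine N M) → Matrix o o ℂ} {α β : ℝ}
    (hα : 0 ≤ α) (hβ : 0 ≤ β) (hv : ∀ x, ‖v x‖ ≤ α) (hvd : ∀ x, ‖v (x + unitVec (fine N M) μ) - v x‖ ≤ β / N) :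
    ‖(sdiff (fine N M) ((N : ℕ) : ℂ) μ ⊗ₖ (1 : Matrix o o ℂ))ᴴ * siteMul v * (Gps N M a' ⊗ₖ (1 : Matrix o o ℂ))‖
      ≤ α * Real.sqrt ((gammaPs d a')⁻¹) + β * (gammaPs d a')⁻¹ := by
  rw [kronSdiff_conjTranspose, Matrix.neg_mul, Matrix.neg_mul, norm_neg, Matrix.mul_assoc, Matrix.mul_assoc]
  calc _ ≤ ‖(shiftS (fine N M) μ ⊗ₖ (1 : Matrix o o ℂ))ᴴ‖
          * ‖sdiff (fine N M) ((N : ℕ) : ℂ) μ ⊗ₖ (1 : Matrix o o ℂ) * (siteMul v * (Gps N M a' ⊗ₖ (1 : Matrix o o ℂ)))‖ :=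
        Matrix.l2_opNorm_mul _ _
    _ ≤ 1 * (α * Real.sqrt ((gammaPs d a')⁻¹) + β * (gammaPs d a')⁻¹) := by
        refine mul_le_mul ?_ ?_ (norm_nonneg _) zero_le_one
        · rw [Matrix.l2_opNorm_conjTranspose]; exact opNorm_kron_le_of_le o (opNorm_shiftS_le _ μ)
        · rw [← Matrix.mul_assoc]; exact opNorm_kronSdiff_siteMul_Gps_le N M ha' μ hα hβ hv hvd
    _ = _ := one_mul _

/-! ## §3 The free scalar averagings pair exactly through the planting -/

/-- **`Q′_{RN}·Q₀ᴴ = R^{−d}·Q′_N`**: averaging a planted 0-form over the unit blocks of the finer lattice is averaging it over the unit blocks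
of the coarser one (`blockOf_{RN} x′ = blockOf_N (par x′)`, `R^d` fine sites per coarse site). [folklore] -/
theorem QsOp_mul_Qavg0H : QsOp (R * N) M * (Qavg0 N R M)ᴴ = (((R : ℂ) ^ d)⁻¹) • QsOp N M := by
  have hRc : (R : ℂ) ≠ 0 := by exact_mod_cast NeZero.ne R
  have hNc : (N : ℂ) ≠ 0 := by exact_mod_cast NeZero.ne N
  ext Y x
  have e1 : (QsOp (R * N) M * (Qavg0 N R M)ᴴ) Y x = ∑ x', QsOp (R * N) M Y x' * Qavg0 N R M x x' := by
    simp only [Matrix.mul_apply, Matrix.conjTranspose_apply, star_Qavg0_apply]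
  rw [e1, sum_fine_eq_sum_tile N R M, Finset.sum_eq_single x]
  · have hterm : ∀ j : Fin d → Fin R, QsOp (R * N) M Y (cpt N R M x + off N R M j) * Qavg0 N R M x (cpt N R M x + off N R M j)
        = ((R : ℂ) ^ d)⁻¹ * QsOp (R * N) M Y (cpt N R M x + off N R M j) := by
      intro j
      rw [Qavg0, par_cpt_add_off, if_pos rfl, mul_comm]
    have hval : ∀ j : Fin d → Fin R, QsOp (R * N) M Y (cpt N R M x + off N R M j) = ((R : ℂ) ^ d)⁻¹ * QsOp N M Y x := by
      intro j
      rw [QsOp_apply_blockOf, QsOp_apply_blockOf, ← blockOf_par N R M, par_cpt_add_off]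
      by_cases h : blockOf N M x = Y
      · rw [if_pos h, if_pos h]; push_cast; rw [mul_pow]; field_simp
      · rw [if_neg h, if_neg h, mul_zero]
    simp_rw [hterm, hval]
    rw [Finset.sum_const, Finset.card_univ, Fintype.card_fun, Fintype.card_fin, Fintype.card_fin, nsmul_eq_mul, Matrix.smul_apply,
      smul_eq_mul]
    push_cast
    field_simp
  · intro y _ hy
    refine Finset.sum_eq_zero fun j _ => ?_
    rw [Qavg0, par_cpt_add_off, if_neg hy, mul_zero]
  · intro h; exact absurd (Finset.mem_univ _) h

/-- **`B_{RN}·(J₀ ⊗ 1) = B_N`**: the normalised free scalar averagings `B_n = √(n^d)·(Q′_n ⊗ 1)` PAIR EXACTLY through King's 0-form planting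
(`q₁ = 0` for the free family of row B4.b's `LayerLaws.pairing_le`). [folklore] -/
theorem Bs_mul_kronJK0 : Bs o (R * N) M * (JK0 N R M ⊗ₖ (1 : Matrix o o ℂ)) = Bs o N M := by
  obtain ⟨_, hss⟩ := sqrt_facts (d := d) R
  have hRd : ((R : ℂ) ^ d) ≠ 0 := pow_ne_zero _ (by exact_mod_cast NeZero.ne R)
  have hsq : (((Real.sqrt ((((R * N : ℕ)) : ℝ) ^ d)) : ℝ) : ℂ)
      = (((Real.sqrt ((R : ℝ) ^ d)) : ℝ) : ℂ) * (((Real.sqrt ((N : ℝ) ^ d)) : ℝ) : ℂ) := by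
    rw [← Complex.ofReal_mul, ← Real.sqrt_mul (pow_nonneg (Nat.cast_nonneg R) d), ← mul_pow, ← Nat.cast_mul]
  rw [Bs, Bs, JK0, Matrix.smul_kronecker, Matrix.smul_mul, Matrix.mul_smul, ← kron_mul, QsOp_mul_Qavg0H, Matrix.smul_kronecker,
    smul_smul, smul_smul, hsq]
  congr 1
  calc _ = ((((Real.sqrt ((R : ℝ) ^ d)) : ℝ) : ℂ) * (((Real.sqrt ((R : ℝ) ^ d)) : ℝ) : ℂ)) * ((R : ℂ) ^ d)⁻¹
          * (((Real.sqrt ((N : ℝ) ^ d)) : ℝ) : ℂ) := by ring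
    _ = (((Real.sqrt ((N : ℝ) ^ d)) : ℝ) : ℂ) := by rw [hss, mul_inv_cancel₀ hRd, one_mul]

end TwoLevel

end Summit.QuantumFields.BalabanUV.T4Continuum.ScalarPlantingFaces

end
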